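import Summits.ResolutionOfSingularities.ResolutionOfSingularities.Theorems.FrobeniusClosingPatchingRelPerfectAtomDimLeThree
import Literature.AlgebraicGeometry.Motives.AbelianVarietyIsogenyProofs
import HarnessLib

/-!
# Crux `PatchingRelPerfect` (stmt-ResolutionOfSingularities-16161), line `closed-point-slice`:
# the OPEN CORE `stub_atomDimFour` in standard terms — local STRONG resolution of fourfolds over
# `κ[[x₁,x₂,x₃,x₄]]` plus Piltant's Axiom 4 (principalization) on regular fourfolds

After skeleton v3 of line `closed-point-slice` the crux `FrobeniusClosing.PatchingRelPerfect` is
closed modulo the printed dimension-`≤ 3` theorems, the dimension-`≥ 5` residual, and ONE local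
statement in dimension 4, the registered stub `stub_atomDimFour`: for a complete regular local `S`
of dimension `4` of characteristic `p` with perfect residue field (`S ≅ κ[[x₁,…,x₄]]`, Cohen) and
an integral `T`, proper and birational over `Spec S` and regular off the closed fibre, there is a
NON-ZERO ideal sheaf on `T`, cosupported in the closed fibre, whose blowing up is regular
(Temkin's single-blow-up desingularization format).

This file records, sorry-free, that the stub is AT MOST the conjunction of the two standard
expected outputs of any resolution programme in dimension 4 — exactly as the dimension-3 case was
derived from Cossart–Piltant 2019 Thm. 1.1 (ii) and Prop. 4.4 (`stub_atomDimLeThree`):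

* (A) **strong resolution** of `T`: a proper birational `φ : Y → T` with `Y` regular which is an
  isomorphism over `Reg T` (the conclusion shape of Cossart–Piltant's Thm. 1.1 (i)–(ii), one
  dimension up);
* (B) **Axiom 4 in blow-up format on regular excellent fourfolds** (Piltant 2013, §2 Axiom 4;
  Cossart–Piltant 2019 Prop. 4.4 one dimension up): on a regular, excellent, integral Noetherian
  scheme `Y` of dimension `4`, every non-zero ideal sheaf `I'` is made an effective Cartier divisor
  by ONE blowing up `σ : Y₁ → Y` along an ideal sheaf cosupported in `V(I')`, with `Y₁` regular.

`atomDimFour_of_strongResolution_of_axiom4` : (A) for `T` ∧ (B) ⟹ the conclusion of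
`stub_atomDimFour` for `T` — through the twin crux's FORMAT UPGRADE
`exists_isBlowup_supported_isRegular_of_isIso_over` (Raynaud–Gruson `Reg T`-admissible domination,
Stacks 080A read backwards, Temkin's Lemma 2.1.4), the singular locus of `T` lying in the closed
fibre. `atomDimFour_of_strongResolutionAll_of_axiom4` is the same with (A) quantified over all
such `T`, i.e. an implication between ∀-statements of the registered shape. Both (A) and (B) are
OPEN in dimension 4 and positive characteristic (Piltant 2013, p. 2: "All of these problems are
open in dimension four or more"; Cossart–Piltant 2019, Rem. 3.2: the dimension-3 strategy breaks
at `Z^p + u₄u₁^p + u₃u₂^p ∈ κ[[u₁,…,u₄]][Z]`); nothing here claims either. No named fact is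
introduced; (A) and (B) appear only as hypotheses.

## References

* O. Piltant, RACSAM 107 (2013) 91–121, §2 Axiom 4, p. 2. [Piltant2013]
* V. Cossart, O. Piltant, J. Algebra 529 (2019) 268–535, Thm. 1.1, Prop. 4.4, Rem. 3.2. [CossartPiltant2019]
* M. Temkin, Adv. Math. 219 (2008), Lemma 2.1.4. [Temkin2008]
* The Stacks Project, Tags 080A, 081T. [StacksProject]
-/

-- `Summit.<Summit>.<Sub>.Theorems` with `Sub = Summit` (single-conjunct summit, D-0017)
set_option linter.dupNamespace false

noncomputable section

open CategoryTheory CategoryTheory.Limits AlgebraicGeometry Literature.AlgebraicGeometry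
open Literature.AlgebraicGeometry.Resolution

namespace Summit.ResolutionOfSingularities.ResolutionOfSingularities.Theorems

/-- **The dimension-4 atom from STRONG RESOLUTION of `T` and AXIOM 4 on regular excellent
fourfolds.** Let `S` be a complete regular local ring of dimension `4`, of characteristic `p`,
with perfect residue field, and `T` an integral scheme, proper and birational over `Spec S`,
regular off the closed fibre. If `T` has a resolution `φ : Y → T` which is an isomorphism over
`Reg T` (A), and non-zero ideal sheaves on regular excellent integral Noetherian schemes of
dimension `4` are principalized by ONE blowing up cosupported in their zero locus with regular
source (B), then `T` carries a non-zero ideal sheaf cosupported in the closed fibre whose blowing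
up is regular. Proof: `T` is Noetherian, separated and excellent (of finite type over the complete,
hence excellent, local ring `S`), `Y` is integral, Noetherian, excellent of dimension `4`
(`topologicalKrullDim_le_of_isProper_of_isBirational` for `Y → Spec S`; the surjection `Y → T`
onto the `4`-dimensional `T`); the format upgrade
`exists_isBlowup_supported_isRegular_of_isIso_over` turns (A) + (B on `Y`) into ONE blowing up of
`T` cosupported in `T ∖ Reg T`, which lies in the closed fibre. A CONDITIONAL result.
[cite: CossartPiltant2019, Thm. 1.1 and Prop. 4.4 (the dimension-3 model); Piltant2013, §2 Axiom 4; Temkin2008, Lemma 2.1.4] -/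
theorem atomDimFour_of_strongResolution_of_axiom4 (p : ℕ)
    (hA4 : ∀ (Y : Scheme.{0}) [IsIntegral Y] [IsNoetherian Y], Scheme.IsRegular Y →
      Scheme.IsExcellent Y → topologicalKrullDim Y = 4 →
      ∀ I' : Y.IdealSheafData, I' ≠ ⊥ →
        ∃ (Q : Y.IdealSheafData) (Y₁ : Scheme.{0}) (σ : Y₁ ⟶ Y),
          (Q.support : Set Y) ⊆ I'.support ∧ IsBlowup σ Q ∧ Scheme.IsRegular Y₁ ∧
            IsEffectiveCartier (I'.comap σ))
    (S : Type) [CommRing S] [IsRegularLocalRing S] [CharP S p]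
    [IsAdicComplete (IsLocalRing.maximalIdeal S) S] [PerfectField (IsLocalRing.ResidueField S)]
    (hdim : ringKrullDim S = (4 : ℕ)) (T : Scheme.{0}) (f : T ⟶ Spec (.of S))
    [IsIntegral T] [IsProper f] (hbir : IsBirational f)
    (hoff : ∀ t : T, f.base t ≠ IsLocalRing.closedPoint S → IsRegularLocalRing (T.presheaf.stalk t))
    (hres : ∃ (Y : Scheme.{0}) (φ : Y ⟶ T), IsResolution φ ∧
      ∃ W : T.Opens, (W : Set T) = Scheme.regularLocus T ∧ IsIso (φ ∣_ W)) :
    ∃ (J : T.IdealSheafData) (T' : Scheme.{0}) (π : T' ⟶ T), J ≠ ⊥ ∧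
      (∀ t : T, t ∈ J.support → f.base t = IsLocalRing.closedPoint S) ∧
      IsBlowup π J ∧ Scheme.IsRegular T' := by
  -- the base: an integral Noetherian excellent affine scheme of dimension `4`
  haveI : IsDomain S := isDomain_of_isRegularLocalRing S
  haveI : IsDomain (CommRingCat.of S) := ‹IsDomain S›
  haveI : IsNoetherianRing (CommRingCat.of S) := (inferInstance : IsNoetherianRing S)
  have hexcS : IsExcellentRing S := isExcellentRing_of_isAdicComplete S
  have hdimS : topologicalKrullDim (Spec (.of S)) ≤ (4 : ℕ) := by
    change topologicalKrullDim (PrimeSpectrum S) ≤ _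
    rw [PrimeSpectrum.topologicalKrullDim_eq_ringKrullDim]
    exact hdim.le
  have hdimS' : topologicalKrullDim (Spec (.of S)) = (4 : ℕ) := by
    change topologicalKrullDim (PrimeSpectrum S) = _
    rw [PrimeSpectrum.topologicalKrullDim_eq_ringKrullDim]
    exact hdim
  -- `T` is Noetherian, separated, excellent, of dimension `4`
  haveI : IsLocallyNoetherian T := LocallyOfFiniteType.isLocallyNoetherian f
  haveI : CompactSpace T := QuasiCompact.compactSpace_of_compactSpace f
  haveI : IsNoetherian T := {}
  haveI : T.IsSeparated := Scheme.isSeparated_of_isSeparated_over f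
  have hdimT : topologicalKrullDim T ≤ (4 : ℕ) :=
    topologicalKrullDim_le_of_isProper_of_isBirational f hbir hdimS
  have hdimT' : topologicalKrullDim T = (4 : ℕ) := by
    apply le_antisymm hdimT
    haveI : Surjective f := ⟨hbir.surjective_of_universallyClosed⟩
    rw [← hdimS']
    exact Literature.AlgebraicGeometry.Motives.Scheme.topologicalKrullDim_le_of_universallyClosed_of_surjective f
  -- singular points of `T` lie over the closed point
  have hsing : ∀ t : T, t ∉ Scheme.regularLocus T → f.base t = IsLocalRing.closedPoint S :=
    fun t ht => by_contra fun h => ht (hoff t h)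
  -- (A): the strong resolution
  obtain ⟨Y, φ, hφ, W, hW, hiso⟩ := hres
  haveI := hφ.isProper
  haveI := hiso
  haveI : IsIntegral Y := by
    haveI := hφ.isRegular.isReduced
    exact hφ.isBirational.isIntegral
  have hgenW : genericPoint T ∈ W := by
    show genericPoint T ∈ (W : Set T)
    rw [hW]
    exact genericPoint_mem_regularLocus T
  -- `Y` is Noetherian and excellent (of finite type over `S` via `φ ≫ f`) of dimension `4`
  haveI : IsLocallyNoetherian Y := LocallyOfFiniteType.isLocallyNoetherian φ
  haveI : CompactSpace Y := QuasiCompact.compactSpace_of_compactSpace φ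
  haveI : IsNoetherian Y := {}
  have hexcY : Scheme.IsExcellent Y :=
    Picover.LocalBlowups.isExcellent_of_locallyOfFiniteType_of_isExcellentRing hexcS (φ ≫ f)
  have hdimY : topologicalKrullDim Y = 4 := by
    apply le_antisymm
    · exact_mod_cast topologicalKrullDim_le_of_isProper_of_isBirational (φ ≫ f)
        (hφ.isBirational.comp hbir) hdimS
    · haveI : Surjective φ := ⟨hφ.isBirational.surjective_of_universallyClosed⟩
      have h4 : (4 : WithBot ℕ∞) = topologicalKrullDim T := by exact_mod_cast hdimT'.symm
      rw [h4]
      exact Literature.AlgebraicGeometry.Motives.Scheme.topologicalKrullDim_le_of_universallyClosed_of_surjective φ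
  -- (B) on `Y`, then the format upgrade
  have hA4Y : ∀ I' : Y.IdealSheafData, I' ≠ ⊥ →
      ∃ (Q : Y.IdealSheafData) (Y₁ : Scheme.{0}) (σ : Y₁ ⟶ Y),
        (Q.support : Set Y) ⊆ I'.support ∧ IsBlowup σ Q ∧ Scheme.IsRegular Y₁ ∧
          IsEffectiveCartier (I'.comap σ) := fun I' hI' =>
    hA4 Y hφ.isRegular hexcY hdimY I' hI'
  obtain ⟨Q', V'', ρ, hQ', hQ'T, hρ, hreg''⟩ :=
    exists_isBlowup_supported_isRegular_of_isIso_over φ W hgenW hA4Y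
  refine ⟨Q', V'', ρ, hQ', fun t ht => hsing t fun hreg => hQ'T ht ?_, hρ, hreg''⟩
  show t ∈ (W : Set T)
  rw [hW]
  exact hreg

/-- **The registered dimension-4 atom (`stub_atomDimFour` of line `closed-point-slice`, statement
shape) from (A) STRONG RESOLUTION of every integral `T` proper and birational over a complete
regular local fourfold base of characteristic `p` with perfect residue field, regular off the
closed fibre, and (B) AXIOM 4 on regular excellent fourfolds.** The open core of the crux
`PatchingRelPerfect` is therefore at most "Cossart–Piltant 2019, Thm. 1.1 (ii) and Prop. 4.4, one
dimension up, over complete regular local bases with perfect residue field". A CONDITIONAL result.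
[cite: CossartPiltant2019, Thm. 1.1 and Prop. 4.4; Piltant2013, p. 2 and §2 Axiom 4] -/
theorem atomDimFour_of_strongResolutionAll_of_axiom4 (p : ℕ)
    (hA : ∀ (S : Type) [CommRing S] [IsRegularLocalRing S] [CharP S p]
      [IsAdicComplete (IsLocalRing.maximalIdeal S) S]
      [PerfectField (IsLocalRing.ResidueField S)], ringKrullDim S = (4 : ℕ) →
      ∀ (T : Scheme.{0}) (f : T ⟶ Spec (.of S)), IsIntegral T → IsProper f → IsBirational f →
        (∀ t : T, f.base t ≠ IsLocalRing.closedPoint S → IsRegularLocalRing (T.presheaf.stalk t)) →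
        ∃ (Y : Scheme.{0}) (φ : Y ⟶ T), IsResolution φ ∧
          ∃ W : T.Opens, (W : Set T) = Scheme.regularLocus T ∧ IsIso (φ ∣_ W))
    (hA4 : ∀ (Y : Scheme.{0}) [IsIntegral Y] [IsNoetherian Y], Scheme.IsRegular Y →
      Scheme.IsExcellent Y → topologicalKrullDim Y = 4 →
      ∀ I' : Y.IdealSheafData, I' ≠ ⊥ →
        ∃ (Q : Y.IdealSheafData) (Y₁ : Scheme.{0}) (σ : Y₁ ⟶ Y),
          (Q.support : Set Y) ⊆ I'.support ∧ IsBlowup σ Q ∧ Scheme.IsRegular Y₁ ∧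
            IsEffectiveCartier (I'.comap σ))
    (S : Type) [CommRing S] [IsRegularLocalRing S] [CharP S p]
    [IsAdicComplete (IsLocalRing.maximalIdeal S) S] [PerfectField (IsLocalRing.ResidueField S)]
    (hdim : ringKrullDim S = (4 : ℕ)) (T : Scheme.{0}) (f : T ⟶ Spec (.of S))
    [IsIntegral T] [IsProper f] (hbir : IsBirational f)
    (hoff : ∀ t : T, f.base t ≠ IsLocalRing.closedPoint S → IsRegularLocalRing (T.presheaf.stalk t)) :
    ∃ (J : T.IdealSheafData) (T' : Scheme.{0}) (π : T' ⟶ T), J ≠ ⊥ ∧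
      (∀ t : T, t ∈ J.support → f.base t = IsLocalRing.closedPoint S) ∧
      IsBlowup π J ∧ Scheme.IsRegular T' :=
  atomDimFour_of_strongResolution_of_axiom4 p hA4 S hdim T f hbir hoff
    (hA S hdim T f inferInstance inferInstance hbir hoff)

end Summit.ResolutionOfSingularities.ResolutionOfSingularities.Theorems

end
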